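import Summits.Parity.GeneralizedHardyLittlewood.Theorems.LiouvilleShiftedTablesTypeI2DilatedURB2
import Literature.NumberTheory.Sieve.BombieriFriedlanderIwaniecBoxes

/-!
# The `𝔲_R` terms of the assembly (`stub_uRBound`), file 3: the box pieces `F_{j,κ}` and Type 0

Route `LiouvilleShiftedTables` (Parity / GeneralizedHardyLittlewood), crux `TypeI2Dilated` (stmt-Parity-14272), line
`peel-to-drappeau`, registered stub `stub_uRBound : URBound`; continuation of `…URB1` (`NS(a) = normSum`), `…URB2`
(the small-mass lemma `normSum_le_of_mass`).

After `λ = 1_□ ⋆ μ` and Heath-Brown's identity for `μ` (`K = 4` factors, truncation `U = ⌊(2x)^{1/4}⌋`), the pieces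
`1_{□,≤K} ⋆ μ_{≤U}^{⋆j} ⋆ ζ^{⋆(j−1)} = ∏_{i<2j} hbFactor K U j i` (`Literature…HeathBrownIdentityLiouville`) are cut into
DYADIC BOXES: slot `i` is restricted to `(2x/2^{κ_i+1}, 2x/2^{κ_i}]` (`BFI.boxRestrict (2x) 1 κ_i`, scale
`V_i = boxScale x κ_i = 2x/2^{κ_i+1}`), giving the box piece `F_{j,κ} = hbBox x ρ j κ = ∏_i hbSlot x ρ j κ i`.
This file records the bookkeeping of these pieces — supports (`hbSlot_ne_zero`, `prod_hbSlot_ne_zero_bounds`), sizes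
(`abs_hbSlot_le_one`, `abs_prod_hbSlot_le`, `abs_prod_hbSlot_le_pow_eight`), the mass of a supported sequence
(`sum_Icc_abs_le_of_support`) — and TYPE 0 (`urb_type0`): if `∏_i V_i ≤ x^{1−ρ₀'}` with `ρ₀' ≥ 60ρ` then
`∑_{m ≤ Y} |F_{j,κ}(m)| ≤ ∑_{m ≤ 2^8 x^{1−ρ₀'}} τ(m)^8 ≤ x^{1−53ρ}` and the small-mass lemma gives `NS(F_{j,κ}) ≤ x^{1−6ρ}`.
[this line: Lines/peel-to-drappeau.md; cite: Drappeau2017, §6; Heathbrown1982, Lemma 1]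
-/

noncomputable section

namespace Summit.Parity.GeneralizedHardyLittlewood.Cruxes.TypeI2Dilated.PeelToDrappeau

open Finset Real Filter
open scoped ArithmeticFunction.sigma ArithmeticFunction.Moebius Classical
open Literature.NumberTheory.Sieve Literature.NumberTheory.Sieve.Drappeau2017

/-! ### The box pieces -/

/-- The Heath-Brown truncation `U = ⌊(2x)^{1/4}⌋`. [this line] -/
def urbU (x : ℝ) : ℕ := ⌊(2 * x) ^ (1 / 4 : ℝ)⌋₊

/-- The scale of the `k`-th dyadic box below `2x`: `V = 2x/2^{k+1}` (`BFI.boxLow (2x) 1 k`). [this line] -/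
def boxScale (x : ℝ) (k : ℕ) : ℝ := BFI.boxLow (2 * x) 1 k

/-- The `i`-th slot of the box piece: `hbFactor K U j i` restricted to the `κ_i`-th dyadic box. [this line] -/
def hbSlot (x ρ : ℝ) (j : ℕ) (κ : Fin (2 * j) → ℕ) (i : Fin (2 * j)) : ArithmeticFunction ℝ :=
  BFI.boxRestrict (2 * x) 1 (κ i) (HeathBrownLiouville.hbFactor (urbK x ρ) (urbU x) j i)

/-- The box piece `F_{j,κ} = ∏_{i < 2j} hbSlot i` (Dirichlet product). [this line] -/
def hbBox (x ρ : ℝ) (j : ℕ) (κ : Fin (2 * j) → ℕ) : ArithmeticFunction ℝ :=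
  ∏ i, hbSlot x ρ j κ i

/-- `boxScale x k = 2x / 2^{k+1}`. [this line] -/
theorem boxScale_eq (x : ℝ) (k : ℕ) : boxScale x k = 2 * x / 2 ^ (k + 1) := by
  simp only [boxScale, BFI.boxLow]; norm_num

/-- `0 < V` for `x > 0`. [this line] -/
theorem boxScale_pos {x : ℝ} (hx : 0 < x) (k : ℕ) : 0 < boxScale x k :=
  BFI.boxLow_pos (by linarith) (by norm_num) k

/-- `V ≤ x`. [this line] -/
theorem boxScale_le {x : ℝ} (hx : 0 ≤ x) (k : ℕ) : boxScale x k ≤ x := by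
  rw [boxScale_eq, div_le_iff₀ (by positivity), pow_succ]
  have : (1 : ℝ) ≤ 2 ^ k := one_le_pow₀ (by norm_num)
  nlinarith

/-- **Support of a slot**: `hbSlot i n ≠ 0 → n ∼ V_i` (and the factor is nonzero there). [this line] -/
theorem hbSlot_ne_zero {x : ℝ} (hx : 0 < x) {ρ : ℝ} {j : ℕ} {κ : Fin (2 * j) → ℕ} {i : Fin (2 * j)} {n : ℕ}
    (h : hbSlot x ρ j κ i n ≠ 0) :
    n ∈ BFI.dyadic (boxScale x (κ i)) ∧ HeathBrownLiouville.hbFactor (urbK x ρ) (urbU x) j i n ≠ 0 := by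
  obtain ⟨hin, hF⟩ := BFI.boxRestrict_ne_zero h
  refine ⟨?_, hF⟩
  obtain ⟨-, h1, h2⟩ := hin
  rw [BFI.boxHigh_eq_mul_boxLow (by norm_num) (κ i)] at h2
  rw [BFI.mem_dyadic (boxScale_pos hx _).le, boxScale]
  exact ⟨h1, by linarith⟩

/-- `|hbSlot i n| ≤ 1`. [this line] -/
theorem abs_hbSlot_le_one (x ρ : ℝ) (j : ℕ) (κ : Fin (2 * j) → ℕ) (i : Fin (2 * j)) (n : ℕ) :
    |hbSlot x ρ j κ i n| ≤ 1 :=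
  (BFI.abs_boxRestrict_le _ _ n).trans (HeathBrownLiouville.abs_hbFactor_le_one _ _ _ _ n)

/-- **Support of a product of slots**: for a nonempty set `S` of slots,
`(∏_{i ∈ S} hbSlot i)(m) ≠ 0 → ∏_{i∈S} V_i < m ≤ ∏_{i ∈ S} 2V_i`. [this line] -/
theorem prod_hbSlot_ne_zero_bounds {x : ℝ} (hx : 0 < x) (ρ : ℝ) {j : ℕ} (κ : Fin (2 * j) → ℕ)
    {S : Finset (Fin (2 * j))} (hS : S.Nonempty) {m : ℕ} (hm : (∏ i ∈ S, hbSlot x ρ j κ i) m ≠ 0) :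
    (∏ i ∈ S, boxScale x (κ i)) < m ∧ (m : ℝ) ≤ ∏ i ∈ S, (2 * boxScale x (κ i)) := by
  refine BFI.prod_apply_ne_zero_bounds hS (fun i _ => (boxScale_pos hx _).le) (fun i _ d hd => ?_) hm
  exact (BFI.mem_dyadic (boxScale_pos hx _).le).1 (hbSlot_ne_zero hx hd).1

/-- `|(∏_{i ∈ S} hbSlot i)(m)| ≤ τ(m)^{#S}`. [this line] -/
theorem abs_prod_hbSlot_le (x ρ : ℝ) {j : ℕ} (κ : Fin (2 * j) → ℕ) (S : Finset (Fin (2 * j))) (m : ℕ) :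
    |(∏ i ∈ S, hbSlot x ρ j κ i) m| ≤ (σ 0 m : ℝ) ^ S.card :=
  abs_prod_apply_le_sigma_zero_pow S _ (fun i _ n => abs_hbSlot_le_one x ρ j κ i n) m

/-- `|(∏_{i ∈ S} hbSlot i)(m)| ≤ τ(m)^8` when `#S ≤ 8`. [this line] -/
theorem abs_prod_hbSlot_le_pow_eight (x ρ : ℝ) {j : ℕ} (κ : Fin (2 * j) → ℕ) {S : Finset (Fin (2 * j))}
    (hS : S.card ≤ 8) (m : ℕ) : |(∏ i ∈ S, hbSlot x ρ j κ i) m| ≤ (σ 0 m : ℝ) ^ 8 := by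
  rcases eq_or_ne m 0 with rfl | hm
  · simp
  · refine (abs_prod_hbSlot_le x ρ κ S m).trans (pow_le_pow_right₀ ?_ hS)
    exact_mod_cast one_le_sigma_zero hm

/-- The box piece as the product over all slots (a `Finset.univ` product). [this line] -/
theorem hbBox_eq_prod_univ (x ρ : ℝ) (j : ℕ) (κ : Fin (2 * j) → ℕ) :
    hbBox x ρ j κ = ∏ i ∈ (Finset.univ : Finset (Fin (2 * j))), hbSlot x ρ j κ i := rfl

/-- `|F_{j,κ}(m)| ≤ τ(m)^8` for `j ≤ 4`. [this line] -/
theorem abs_hbBox_le {x ρ : ℝ} {j : ℕ} (hj : j ≤ 4) (κ : Fin (2 * j) → ℕ) (m : ℕ) :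
    |hbBox x ρ j κ m| ≤ (σ 0 m : ℝ) ^ 8 :=
  abs_prod_hbSlot_le_pow_eight x ρ κ (by rw [Finset.card_univ, Fintype.card_fin]; omega) m

/-- Support of `F_{j,κ}` (`j ≥ 1`): `F_{j,κ}(m) ≠ 0 → ∏ V_i < m ≤ 2^{2j} ∏ V_i`. [this line] -/
theorem hbBox_ne_zero_bounds {x : ℝ} (hx : 0 < x) (ρ : ℝ) {j : ℕ} (hj : 1 ≤ j) (κ : Fin (2 * j) → ℕ) {m : ℕ}
    (hm : hbBox x ρ j κ m ≠ 0) :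
    (∏ i, boxScale x (κ i)) < m ∧ (m : ℝ) ≤ 2 ^ (2 * j) * ∏ i, boxScale x (κ i) := by
  have hne : (Finset.univ : Finset (Fin (2 * j))).Nonempty := ⟨⟨0, by omega⟩, Finset.mem_univ _⟩
  obtain ⟨h1, h2⟩ := prod_hbSlot_ne_zero_bounds hx ρ κ hne hm
  refine ⟨h1, h2.trans (le_of_eq ?_)⟩
  rw [Finset.prod_mul_distrib, Finset.prod_const, Finset.card_univ, Fintype.card_fin]

/-! ### The mass of a supported sequence -/

/-- If `F` is supported on `m ≤ M₀` and `|F| ≤ g` with `g ≥ 0`, then `∑_{1 ≤ m ≤ N} |F(m)| ≤ ∑_{1 ≤ m ≤ M₀} g(m)`.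
[folklore] -/
theorem sum_Icc_abs_le_of_support {F g : ℕ → ℝ} {M₀ : ℝ} (hsupp : ∀ m, F m ≠ 0 → (m : ℝ) ≤ M₀)
    (hg : ∀ m, |F m| ≤ g m) (N : ℕ) :
    ∑ m ∈ Icc 1 N, |F m| ≤ ∑ m ∈ Icc 1 ⌊M₀⌋₊, g m := by
  have hg0 : ∀ m, 0 ≤ g m := fun m => (abs_nonneg _).trans (hg m)
  rw [← Finset.sum_filter_of_ne (p := fun m => m ≤ ⌊M₀⌋₊) (fun m _ hm => Nat.le_floor
    (hsupp m (fun h0 => hm (by rw [h0, abs_zero]))))]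
  calc ∑ m ∈ (Icc 1 N).filter (fun m => m ≤ ⌊M₀⌋₊), |F m| ≤ ∑ m ∈ Icc 1 ⌊M₀⌋₊, |F m| := by
        refine Finset.sum_le_sum_of_subset_of_nonneg (fun m hm => ?_) fun _ _ _ => abs_nonneg _
        rw [Finset.mem_filter, Finset.mem_Icc] at hm
        exact Finset.mem_Icc.2 ⟨hm.1.1, hm.2⟩
    _ ≤ _ := Finset.sum_le_sum fun m _ => hg m

/-- `∑_{m ≤ M} τ(m)^8 ≤ C M (log M)^{512}` for `M ≥ 2`. [folklore] -/
theorem exists_sum_sigma_pow_eight_le :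
    ∃ C : ℝ, 0 < C ∧ ∀ M : ℝ, 2 ≤ M → ∑ m ∈ Icc 1 ⌊M⌋₊, (σ 0 m : ℝ) ^ 8 ≤ C * M * Real.log M ^ 512 := by
  obtain ⟨C, hC, h⟩ := exists_sum_sigma_zero_pow_le_real 8
  exact ⟨C, hC, fun M hM => by simpa using h M hM⟩

/-! ### Type 0 -/

/-- **Type 0**: for `0 < ρ ≤ 1/100`, `60ρ ≤ ρ₀' ≤ 1` and `x ≥ x₀(ρ, ρ₀', c)`, in the regime of `URBound`, every box piece
with `∏_i V_i ≤ x^{1−ρ₀'}` (`1 ≤ j ≤ 4`) has `NS(F_{j,κ}) ≤ x^{1−6ρ}`: its mass on `[1, Y]` is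
`≤ ∑_{m ≤ 2^8 x^{1−ρ₀'}} τ(m)^8 ≤ x^{1−53ρ}` and its values are `≤ τ^8` (small-mass lemma). [this line] -/
theorem urb_type0 (c : ℤ) {ρ ρ₀' : ℝ} (hρ : 0 < ρ) (hρ1 : ρ ≤ 1 / 100) (h60 : 60 * ρ ≤ ρ₀') (hρ₀' : ρ₀' ≤ 1) :
    ∃ x₀ : ℝ, ∀ x : ℝ, x₀ ≤ x → ∀ w : ℕ, ∀ Y R Slo : ℝ, ∀ P : ℕ, 1 ≤ P → Y ≤ 2 * x → 1 ≤ R →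
      (P : ℝ) * R ≤ x ^ (4 * ρ) → 0 ≤ Slo → 2 * Slo * R * P ≤ x ^ (1 / 2 + ρ) →
      ∀ j ∈ Icc 1 4, ∀ κ : Fin (2 * j) → ℕ, (∏ i, boxScale x (κ i)) ≤ x ^ (1 - ρ₀') →
        normSum c w P x ρ Y R Slo (fun m => hbBox x ρ j κ m) ≤ x ^ (1 - 6 * ρ) := by
  obtain ⟨x₁, hx₁⟩ := normSum_le_of_mass c hρ hρ1 ((σ 0 c.natAbs : ℝ) ^ 8)
  obtain ⟨C₈, hC₈, h8⟩ := exists_sum_sigma_pow_eight_le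
  have hev : ∀ᶠ x : ℝ in atTop, C₈ * 2 ^ 8 * Real.log x ^ 512 ≤ x ^ (7 * ρ) ∧ (2 : ℝ) ^ 8 ≤ x ^ (60 * ρ) ∧
      (2 : ℝ) ≤ x :=
    (eventually_mul_log_pow_le _ 512 (by linarith)).and ((eventually_le_rpow _ (by linarith)).and
      (eventually_ge_atTop _))
  obtain ⟨x₂, hx₂⟩ := Filter.eventually_atTop.1 hev
  refine ⟨max x₁ x₂, fun x hx w Y R Slo P hP hY hR hPR hSlo hSRP j hj κ hPV => ?_⟩
  obtain ⟨e1, e2, e3⟩ := hx₂ x ((le_max_right _ _).trans hx)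
  rw [Finset.mem_Icc] at hj
  have hx1 : 1 ≤ x := by linarith
  have hx0 : 0 < x := by linarith
  refine hx₁ x ((le_max_left _ _).trans hx) w Y R Slo P hP hY hR hPR hSlo hSRP _ ?_ ?_
  · -- the mass
    set M₀ : ℝ := 2 ^ 8 * x ^ (1 - ρ₀') with hM₀
    have hxρ₀ : 1 ≤ x ^ (1 - ρ₀') := Real.one_le_rpow hx1 (by linarith)
    have hx60 : x ^ (1 - ρ₀') ≤ x ^ (1 - 60 * ρ) := Real.rpow_le_rpow_of_exponent_le hx1 (by linarith)
    have hM₀2 : 2 ≤ M₀ := by rw [hM₀]; nlinarith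
    have hM₀x : M₀ ≤ x := by
      calc M₀ ≤ x ^ (60 * ρ) * x ^ (1 - 60 * ρ) := by
            rw [hM₀]; exact mul_le_mul e2 hx60 (by linarith) (Real.rpow_nonneg hx0.le _)
        _ = x := by rw [← Real.rpow_add hx0]; ring_nf; exact Real.rpow_one x
    have hsupp : ∀ m, hbBox x ρ j κ m ≠ 0 → (m : ℝ) ≤ M₀ := by
      intro m hm
      obtain ⟨-, h2⟩ := hbBox_ne_zero_bounds hx0 ρ hj.1 κ hm
      refine h2.trans ?_
      rw [hM₀]
      have h22 : (2 : ℝ) ^ (2 * j) ≤ 2 ^ 8 := pow_le_pow_right₀ (by norm_num) (by omega)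
      have hP0 : 0 ≤ ∏ i, boxScale x (κ i) := Finset.prod_nonneg fun i _ => (boxScale_pos hx0 _).le
      exact mul_le_mul h22 hPV hP0 (by positivity)
    calc ∑ m ∈ Icc 1 ⌊Y⌋₊, |hbBox x ρ j κ m| ≤ ∑ m ∈ Icc 1 ⌊M₀⌋₊, (σ 0 m : ℝ) ^ 8 :=
          sum_Icc_abs_le_of_support hsupp (abs_hbBox_le hj.2 κ) _
      _ ≤ C₈ * M₀ * Real.log M₀ ^ 512 := h8 M₀ hM₀2
      _ ≤ C₈ * (2 ^ 8 * x ^ (1 - ρ₀')) * Real.log x ^ 512 := by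
          have hlog : Real.log M₀ ≤ Real.log x := Real.log_le_log (by linarith) hM₀x
          have hlog0 : 0 ≤ Real.log M₀ := Real.log_nonneg (by linarith)
          rw [hM₀]
          gcongr
      _ = (C₈ * 2 ^ 8 * Real.log x ^ 512) * x ^ (1 - ρ₀') := by ring
      _ ≤ x ^ (7 * ρ) * x ^ (1 - 60 * ρ) := mul_le_mul e1 hx60 (by positivity) (Real.rpow_nonneg hx0.le _)
      _ = x ^ (1 - 53 * ρ) := by rw [← Real.rpow_add hx0]; ring_nf
  · exact sum_filter_eq_le_sigma_pow (fun m => abs_hbBox_le hj.2 κ m) Y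

/-- Landing anchor of the `𝔲_R`-bound chain, file 3; registered stub `urbChain3_anchor` of the crux item (the
mathematical content of this file is `urb_type0`). -/
theorem urbChain3_anchor : True := trivial

end Summit.Parity.GeneralizedHardyLittlewood.Cruxes.TypeI2Dilated.PeelToDrappeau

end
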